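import Literature.NumberTheory.Transcendental.KZBetaUnitExponent
import Literature.NumberTheory.Transcendental.KZDirichletCharts
import Summits.KontsevichZagierPeriods.KontsevichZagierPeriods.Theorems.SoloBlindPiGraphsReps
import Summits.KontsevichZagierPeriods.KontsevichZagierPeriods.Theorems.SoloBlindBoxExamples
import HarnessLib

/-!
# Beta classes in the formal period ring `Q`

The Literature realises three classical Beta-function identities as single moves of
Kontsevich–Zagier's calculus (2001, §1.2), for representations pinned by domain and integrand:
the symmetry `B(a,b) = B(b,a)` (`KZ.betaReflection_equivalent`), the translation
`(a+b)B(a,b+1) = bB(a,b)` (`KZ.betaTranslation_equivalent`, integration by parts), the unit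
exponent `B(a,1) = 1/a` (`KZ.betaFirst_equivalent_unit_constMul`) and Dirichlet's re-association
`B(a+b,c)B(a,b) = B(b,c)B(a,b+c)` (`KZ.dirichletPolar_equivalent`, `KZ.dirichletLinear_equivalent`).
This file packages them as IDENTITIES in the `K₀`-algebra `Q = FormalRep ⧸ relations` of
`SoloBlindBoxRing` between the **Beta classes** `β(a,b) = [betaRep a b]`,
`betaRep a b = [(0,1), t^{a-1}(1-t)^{b-1}]` (`a, b ∈ ℚ_{>0}`):

* `betaQ_symm`, `betaQ_transl`, `betaQ_first`, `betaQ_dirichlet`;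
* `mkQ_constMul`: scaling a representation by a real algebraic constant is the scalar action;
* `betaQ_half_half`: `β(½,½) = x_π` — ONE rational change of variables `t = u²/(1+u²)` from
  `[(0,∞), 2/(1+u²)]`, then the rank-one theorem of `SoloBlindBoxRankOne`.

These are the bookkeeping steps of Euler's lemniscate relation inside the rules
(`SoloBlindLemniscate`).

References: M. Kontsevich, D. Zagier, *Periods* (2001), §1.2; G. Andrews, R. Askey, R. Roy,
*Special Functions* (1999), §1.1 and Thm 1.8.1.
-/

noncomputable section

namespace Summit.KontsevichZagierPeriods.KontsevichZagierPeriods.Theorems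

open Set MeasureTheory
open Literature.ModelTheory.ExponentialFields (IsSemialgebraic)
open Literature.NumberTheory.Transcendental
open Literature.NumberTheory.Transcendental.KZ
open Literature.Analysis.SpecialFunctions.Selberg
  (integrableOn_Ioo_rpow_mul_one_sub_rpow_and_integral_eq)

namespace SoloBlind

/-! ## Scaling by an algebraic constant is the scalar action -/

/-- `c · r` re-indexed along `Fin n ≃ Fin (0 + n)` is `K(c) × r`, as representations. -/
theorem constMul_reindex_eq_constCell_prod {n : ℕ} (r : IntegralRep n) (c : ℝ)
    (hc : IsAlgebraic ℚ c) :
    (r.constMul c hc).reindex (finCongr (Nat.zero_add n).symm) = (constCell c hc).prod r := by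
  refine IntegralRep.ext' ?_ ?_
  · ext w
    simp only [IntegralRep.reindex_domain, mem_setOf_eq, finCongr_zero_add_symm_apply,
      IntegralRep.prod_domain, IntegralRep.mem_prodDomain, constCell_domain, mem_univ, true_and,
      IntegralRep.domain_constMul]
  · ext w
    simp only [IntegralRep.reindex_integrand, finCongr_zero_add_symm_apply,
      IntegralRep.integrand_constMul, IntegralRep.prod_integrand_eq, IntegralRep.prodFun_apply,
      constCell_integrand]

/-- **Scaling is the scalar action**: `[c · r] = c • [r]` in `Q` for a real algebraic `c`. -/
theorem mkQ_constMul {n : ℕ} (r : IntegralRep n) (c : ℝ) (hc : IsAlgebraic ℚ c) :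
    mkQ (of (r.constMul c hc)) = (⟨c, mem_K₀_iff.mpr hc⟩ : K₀) • mkQ (of r) := by
  rw [smul_eq_kappa_mul, kappa_mk c hc, ← mkQ_mul, of_mul_of,
    ← constMul_reindex_eq_constCell_prod, mkQ_eq_mkQ_iff]
  exact of_sub_of_reindex_mem_relations _ _

/-- Scaling by a rational constant: `[q · r] = q • [r]`. -/
theorem mkQ_constMul_ratCast {n : ℕ} (r : IntegralRep n) (q : ℚ) :
    mkQ (of (r.constMul (q : ℝ) (isAlgebraic_rat ℚ q))) = (q : K₀) • mkQ (of r) := by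
  rw [mkQ_constMul]
  exact congrArg (· • mkQ (of r)) (Subtype.ext rfl)

/-- The Literature unit `[pt, 1]` is the point cell `K(1)`. -/
theorem unit_eq_constCell : IntegralRep.unit = constCell 1 isAlgebraic_one :=
  IntegralRep.ext' rfl rfl

/-! ## The Beta representations -/

/-- **The Beta representation** `β(a,b) = [(0,1), t^{a-1}(1-t)^{b-1}]` for rationals
`a, b > 0` (an algebraic, not rational, integrand unless `a, b ∈ ℤ`). -/
def betaRep (a b : ℚ) (ha : 0 < a) (hb : 0 < b) : IntegralRep 1 :=
  lineRep (Ioo 0 1) (fun t => t ^ ((a : ℝ) - 1) * (1 - t) ^ ((b : ℝ) - 1))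
    (isSemialgebraic_line_Ioo isAlgebraic_zero isAlgebraic_one)
    ((isSemialgebraicFunOn_const_mul_rpow_mul_rpow 1 (a - 1) (b - 1)).congr fun x _ => by
      push_cast
      ring)
    (integrableOn_Ioo_rpow_mul_one_sub_rpow_and_integral_eq (Rat.cast_pos.mpr ha)
      (Rat.cast_pos.mpr hb)).1

section beta

variable {a b : ℚ} {ha : 0 < a} {hb : 0 < b}

/-- The domain of `β(a,b)` is `(0,1) ⊆ ℝ¹`. -/
@[simp] theorem betaRep_domain : (betaRep a b ha hb).domain = {x | x 0 ∈ Ioo (0:ℝ) 1} := rfl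

/-- The integrand of `β(a,b)`. -/
@[simp] theorem betaRep_integrand :
    (betaRep a b ha hb).integrand =
      fun x => (x 0) ^ ((a : ℝ) - 1) * (1 - x 0) ^ ((b : ℝ) - 1) :=
  rfl

/-- `value β(a,b) = Γ(a)Γ(b)/Γ(a+b)`. -/
theorem betaRep_value :
    (betaRep a b ha hb).value = Real.Gamma a * Real.Gamma b / Real.Gamma (a + b) := by
  rw [betaRep, value_lineRep]
  exact (integrableOn_Ioo_rpow_mul_one_sub_rpow_and_integral_eq (Rat.cast_pos.mpr ha)
    (Rat.cast_pos.mpr hb)).2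

end beta

open scoped Classical in
/-- **The Beta class** `β(a,b) = [betaRep a b] ∈ Q` (and `0` unless `a, b > 0`). -/
def betaQ (a b : ℚ) : Q :=
  if h : 0 < a ∧ 0 < b then mkQ (of (betaRep a b h.1 h.2)) else 0

section identities

variable {a b c : ℚ}

/-- Unfolding `β(a,b)`. -/
theorem betaQ_eq (ha : 0 < a) (hb : 0 < b) : betaQ a b = mkQ (of (betaRep a b ha hb)) := by
  rw [betaQ, dif_pos ⟨ha, hb⟩]

/-- `evalQ β(a,b) = Γ(a)Γ(b)/Γ(a+b)`. -/
theorem evalQ_betaQ (ha : 0 < a) (hb : 0 < b) :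
    evalQ (betaQ a b) = Real.Gamma a * Real.Gamma b / Real.Gamma (a + b) := by
  rw [betaQ_eq ha hb, evalQ_mkQ, eval_of, betaRep_value]

/-- **Pinning**: a representation with domain `(0,1)` whose integrand agrees there with
`t^{a-1}(1-t)^{b-1}` has class `β(a,b)` (one integrand-additivity move). -/
theorem mkQ_eq_betaQ (ha : 0 < a) (hb : 0 < b) (ρ : IntegralRep 1)
    (hρd : ρ.domain = {x | x 0 ∈ Ioo (0:ℝ) 1})
    (hρi : EqOn ρ.integrand (fun x => (x 0) ^ ((a : ℝ) - 1) * (1 - x 0) ^ ((b : ℝ) - 1))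
      ρ.domain) :
    mkQ (of ρ) = betaQ a b := by
  rw [betaQ_eq ha hb, mkQ_eq_mkQ_iff]
  exact of_sub_of_mem_relations_of_eqOn (betaRep_domain.trans hρd.symm) hρi

/-- **Symmetry** `β(a,b) = β(b,a)`: one change of variables `t ↦ 1 - t`
(`KZ.betaReflection_equivalent`). -/
theorem betaQ_symm (ha : 0 < a) (hb : 0 < b) : betaQ a b = betaQ b a := by
  rw [betaQ_eq ha hb, betaQ_eq hb ha, mkQ_eq_mkQ_iff]
  exact betaReflection_equivalent ((a : ℝ) - 1) ((b : ℝ) - 1) (betaRep a b ha hb)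
    (betaRep b a hb ha) rfl (fun x _ => rfl) rfl (fun x _ => rfl)

/-- **Translation** `(a+b)·β(a,b+1) = b·β(a,b)`: one Newton–Leibniz move, integration by parts
inside the rules (`KZ.betaTranslation_equivalent`). -/
theorem betaQ_transl (ha : 0 < a) (hb : 0 < b) :
    ((a + b : ℚ) : K₀) • betaQ a (b + 1) = (b : K₀) • betaQ a b := by
  have hb1 : 0 < b + 1 := add_pos hb one_pos
  set ρ := (betaRep a (b + 1) ha hb1).constMul ((a + b : ℚ) : ℝ) (isAlgebraic_rat ℚ (a + b))
    with hρ
  set ρ' := (betaRep a b ha hb).constMul ((b : ℚ) : ℝ) (isAlgebraic_rat ℚ b) with hρ'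
  have h : Equivalent ρ ρ' := by
    refine betaTranslation_equivalent a b ha hb ρ ρ' rfl (fun x _ => ?_) rfl (fun x _ => ?_)
    · simp only [hρ, IntegralRep.integrand_constMul, betaRep_integrand]
      push_cast
      rw [add_sub_cancel_right]
    · simp only [hρ', IntegralRep.integrand_constMul, betaRep_integrand]
  have e1 : mkQ (of ρ) = ((a + b : ℚ) : K₀) • betaQ a (b + 1) := by
    rw [hρ, mkQ_constMul_ratCast, betaQ_eq ha hb1]
  have e2 : mkQ (of ρ') = (b : K₀) • betaQ a b := by
    rw [hρ', mkQ_constMul_ratCast, betaQ_eq ha hb]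
  rw [← e1, ← e2, mkQ_eq_mkQ_iff]
  exact h

/-- **Unit exponent** `a·β(a,1) = 1`: one Newton–Leibniz move
(`KZ.betaFirst_equivalent_unit_constMul`). -/
theorem betaQ_first (ha : 0 < a) : (a : K₀) • betaQ a 1 = 1 := by
  have hinv : IsAlgebraic ℚ ((a : ℝ)⁻¹) := by
    have h := isAlgebraic_rat ℚ (A := ℝ) a⁻¹
    simpa using h
  have h : Equivalent (betaRep a 1 ha one_pos) (IntegralRep.unit.constMul ((a : ℝ)⁻¹) hinv) :=
    betaFirst_equivalent_unit_constMul a ha (betaRep a 1 ha one_pos) rfl (fun x _ => rfl) hinv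
  have e : betaQ a 1 = (a : K₀)⁻¹ • (1 : Q) := by
    rw [betaQ_eq ha one_pos, one_eq_mkQ, ← unit_eq_constCell]
    have h2 : mkQ (of (IntegralRep.unit.constMul ((a : ℝ)⁻¹) hinv)) =
        (a : K₀)⁻¹ • mkQ (of IntegralRep.unit) := by
      rw [mkQ_constMul]
      exact congrArg (· • mkQ (of IntegralRep.unit)) (Subtype.ext (by push_cast; rfl))
    rw [← h2, mkQ_eq_mkQ_iff]
    exact h
  have ha' : (a : K₀) ≠ 0 := by exact_mod_cast ha.ne'
  rw [e, smul_smul, mul_inv_cancel₀ ha', one_smul]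

/-- The domain of a product of two Beta representations is the open box `(0,1)²`. -/
theorem betaRep_prod_domain {a' b' : ℚ} (ha : 0 < a) (hb : 0 < b) (ha' : 0 < a') (hb' : 0 < b') :
    ((betaRep a b ha hb).prod (betaRep a' b' ha' hb')).domain =
      {z : Fin 2 → ℝ | z 0 ∈ Ioo (0:ℝ) 1 ∧ z 1 ∈ Ioo (0:ℝ) 1} := by
  ext z
  simp only [IntegralRep.prod_domain, IntegralRep.mem_prodDomain, betaRep_domain, mem_setOf_eq,
    (show (Fin.castAdd 1 (0 : Fin 1) : Fin 2) = 0 from rfl),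
    (show (Fin.natAdd 1 (0 : Fin 1) : Fin 2) = 1 from rfl)]

/-- The integrand of a product of two Beta representations. -/
theorem betaRep_prod_integrand {a' b' : ℚ} (ha : 0 < a) (hb : 0 < b) (ha' : 0 < a')
    (hb' : 0 < b') (z : Fin 2 → ℝ) :
    ((betaRep a b ha hb).prod (betaRep a' b' ha' hb')).integrand z =
      (z 0) ^ ((a : ℝ) - 1) * (1 - z 0) ^ ((b : ℝ) - 1) *
        ((z 1) ^ ((a' : ℝ) - 1) * (1 - z 1) ^ ((b' : ℝ) - 1)) := by
  rw [IntegralRep.prod_integrand_eq, IntegralRep.prodFun_apply]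
  simp only [betaRep_integrand, (show (Fin.castAdd 1 (0 : Fin 1) : Fin 2) = 0 from rfl),
    (show (Fin.natAdd 1 (0 : Fin 1) : Fin 2) = 1 from rfl)]

/-- **Dirichlet's re-association** `β(a+b,c)·β(a,b) = β(b,c)·β(a,b+c)`: two changes of
variables through the simplex (`KZ.dirichletPolar_equivalent`, `KZ.dirichletLinear_equivalent`)
and Fubini (`KZ.of_mul_of`). -/
theorem betaQ_dirichlet (ha : 0 < a) (hb : 0 < b) (hc : 0 < c) :
    betaQ (a + b) c * betaQ a b = betaQ b c * betaQ a (b + c) := by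
  have hab : 0 < a + b := add_pos ha hb
  have hbc : 0 < b + c := add_pos hb hc
  set P := (betaRep (a + b) c hab hc).prod (betaRep a b ha hb) with hP
  set B := (betaRep b c hb hc).prod (betaRep a (b + c) ha hbc) with hB
  have hPd : P.domain = {z : Fin 2 → ℝ | z 0 ∈ Ioo (0:ℝ) 1 ∧ z 1 ∈ Ioo (0:ℝ) 1} :=
    betaRep_prod_domain hab hc ha hb
  have hPi : EqOn P.integrand (fun z => (z 0) ^ ((a : ℝ) + b - 1) * (1 - z 0) ^ ((c : ℝ) - 1) *
      ((z 1) ^ ((a : ℝ) - 1) * (1 - z 1) ^ ((b : ℝ) - 1))) P.domain := by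
    intro z _
    rw [hP, betaRep_prod_integrand hab hc ha hb z]
    push_cast
    rfl
  obtain ⟨S, hSd, hSi, hPS⟩ := dirichletPolar_equivalent a b c P hPd hPi
  have hBd : B.domain = {z : Fin 2 → ℝ | z 0 ∈ Ioo (0:ℝ) 1 ∧ z 1 ∈ Ioo (0:ℝ) 1} :=
    betaRep_prod_domain hb hc ha hbc
  have hBi : EqOn B.integrand (fun z => (z 0) ^ ((b : ℝ) - 1) * (1 - z 0) ^ ((c : ℝ) - 1) *
      ((z 1) ^ ((a : ℝ) - 1) * (1 - z 1) ^ ((b : ℝ) + c - 1))) B.domain := by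
    intro z _
    rw [hB, betaRep_prod_integrand hb hc ha hbc z]
    push_cast
    rfl
  have hSB : Equivalent S B := dirichletLinear_equivalent a b c S B hSd hSi hBd hBi
  rw [betaQ_eq hab hc, betaQ_eq ha hb, betaQ_eq hb hc, betaQ_eq ha hbc, ← mkQ_mul, ← mkQ_mul,
    of_mul_of, of_mul_of, mkQ_eq_mkQ_iff]
  have e : of P - of B = (of P - of S) + (of S - of B) := by abel
  rw [← hP, ← hB, e]
  exact relations.add_mem hPS hSB

end identities

/-! ## `β(½,½) = x_π`: one rational change of variables from `[(0,∞), 2/(1+u²)]` -/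

/-- The pull-back identity of the chart `t = u²/(1+u²)`:
`t^{-1/2}(1-t)^{-1/2} · |dt/du| = 2/(1+u²)` for `u > 0`. -/
theorem betaHalf_pullback {u : ℝ} (hu : 0 < u) :
    2 / (1 + u ^ 2) =
      (u ^ 2 / (1 + u ^ 2)) ^ ((((1:ℚ) / 2 : ℚ) : ℝ) - 1) *
        (1 - u ^ 2 / (1 + u ^ 2)) ^ ((((1:ℚ) / 2 : ℚ) : ℝ) - 1) *
          |2 * u / (1 + u ^ 2) ^ 2| := by
  have h1 : (0:ℝ) < 1 + u ^ 2 := by positivity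
  have he : ((((1:ℚ) / 2 : ℚ) : ℝ) - 1) = -((1:ℝ) / 2) := by norm_num
  have ht0 : 0 ≤ u ^ 2 / (1 + u ^ 2) := by positivity
  have h1t : 1 - u ^ 2 / (1 + u ^ 2) = 1 / (1 + u ^ 2) := by
    field_simp
    ring
  have hs0 : 0 < Real.sqrt (1 + u ^ 2) := Real.sqrt_pos.mpr h1
  have hs2 : Real.sqrt (1 + u ^ 2) ^ 2 = 1 + u ^ 2 := Real.sq_sqrt h1.le
  rw [he, h1t, Real.rpow_neg ht0, Real.rpow_neg (by positivity), ← Real.sqrt_eq_rpow,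
    ← Real.sqrt_eq_rpow, Real.sqrt_div' _ h1.le, Real.sqrt_sq hu.le, Real.sqrt_div' _ h1.le,
    Real.sqrt_one, abs_of_pos (by positivity)]
  field_simp
  nlinarith [hs2, hs0]

/-- **`[(0,∞), 2/(1+u²)] ≡ β(½,½)`** by the rational change of variables `t = u²/(1+u²)`
(`(0,∞) → (0,1)` bijective, `dt = 2u du/(1+u²)²`). -/
theorem twoAtanHalfLine_sub_betaRep_half :
    of twoAtanHalfLine - of (betaRep (1 / 2) (1 / 2) (by norm_num) (by norm_num)) ∈
      relations := by
  unfold twoAtanHalfLine betaRep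
  refine lineRep_subst (fun u => u ^ 2 / (1 + u ^ 2)) (fun u => 2 * u / (1 + u ^ 2) ^ 2)
    ?_ ?_ ?_ ?_ ?_
  · have h := isSemialgebraicFunOn_aeval_div_aeval (isSemialgebraic_line_Ioi isAlgebraic_zero)
      (MvPolynomial.X 0 ^ 2) (1 + MvPolynomial.X 0 ^ 2 : MvPolynomial (Fin 1) ℚ) (fun x _ => by
        have : (0:ℝ) < 1 + x 0 ^ 2 := by positivity
        simpa using this.ne')
    refine h.congr fun x _ => ?_
    simp
  · intro t ht
    have h1 : (0:ℝ) < 1 + t ^ 2 := by positivity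
    have hd : HasDerivAt (fun u : ℝ => u ^ 2 / (1 + u ^ 2)) (2 * t / (1 + t ^ 2) ^ 2) t := by
      have hn : HasDerivAt (fun u : ℝ => u ^ 2) (2 * t) t := by
        simpa using hasDerivAt_pow 2 t
      have hden : HasDerivAt (fun u : ℝ => 1 + u ^ 2) (2 * t) t := by
        simpa using (hasDerivAt_pow 2 t).const_add 1
      refine (hn.div hden h1.ne').congr_deriv ?_
      rw [div_left_inj' (pow_ne_zero 2 h1.ne')]
      ring
    exact hd.hasDerivWithinAt
  · intro u hu v hv huv
    have hu' : (0:ℝ) < u := hu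
    have hv' : (0:ℝ) < v := hv
    have h1 : (0:ℝ) < 1 + u ^ 2 := by positivity
    have h2 : (0:ℝ) < 1 + v ^ 2 := by positivity
    have e : u ^ 2 / (1 + u ^ 2) = v ^ 2 / (1 + v ^ 2) := huv
    rw [div_eq_div_iff h1.ne' h2.ne'] at e
    have e2 : (u - v) * (u + v) = 0 := by linear_combination e
    rcases mul_eq_zero.mp e2 with h | h
    · linarith
    · linarith
  · ext t
    constructor
    · rintro ⟨ht0, ht1⟩
      have h1t : 0 < 1 - t := by linarith
      refine ⟨Real.sqrt (t / (1 - t)), Real.sqrt_pos.mpr (div_pos ht0 h1t), ?_⟩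
      show Real.sqrt (t / (1 - t)) ^ 2 / (1 + Real.sqrt (t / (1 - t)) ^ 2) = t
      have h1t' : (1:ℝ) - t ≠ 0 := h1t.ne'
      have e1 : 1 + t / (1 - t) = 1 / (1 - t) := by
        field_simp
        ring
      rw [Real.sq_sqrt (div_pos ht0 h1t).le, e1, div_div_eq_mul_div, div_one,
        div_mul_cancel₀ _ h1t']
    · rintro ⟨u, hu, rfl⟩
      have hu' : (0:ℝ) < u := hu
      have h1 : (0:ℝ) < 1 + u ^ 2 := by positivity
      exact ⟨div_pos (by positivity) h1, (div_lt_one h1).mpr (by linarith)⟩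
  · intro u hu
    exact betaHalf_pullback hu

/-- `[(0,∞), 2/(1+u²)] = x_π` in `Q` (the rank-one theorem for `B(π)`). -/
theorem mkQ_twoAtanHalfLine : mkQ (of twoAtanHalfLine) = xPi := by
  have hA : of (atanCell ((1:ℚ) : ℝ) 1 (isAlgebraic_rat ℚ 1) isAlgebraic_one) ∈
      lineRing Real.pi :=
    atanCell_one_mem_lineRing 1
  rw [atanCell_congr Rat.cast_one rfl (hd' := isAlgebraic_one) (hτ' := isAlgebraic_one)] at hA
  have hz : of twoAtanHalfLine - 4 • of (atanCell 1 1 isAlgebraic_one isAlgebraic_one) ∈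
      lineRing Real.pi :=
    sub_mem (NonUnitalSubring.subset_closure of_twoAtanHalfLine_mem_lineGens) (nsmul_mem hA 4)
  have h0 : eval (of twoAtanHalfLine - 4 • of (atanCell 1 1 isAlgebraic_one isAlgebraic_one)) =
      0 := by
    rw [map_sub, map_nsmul, eval_of, eval_of, twoAtanHalfLine_value, value_atanCell zero_le_one,
      Real.arctan_one]
    ring
  have h := lineRing_kernel_pi hz h0
  rw [← sub_eq_zero, xPi, alpha_eq isAlgebraic_one, ofNat_smul_eq_nsmul, ← map_nsmul,
    ← map_sub, mkQ_eq_zero_iff]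
  exact h

/-- **`β(½,½) = x_π`** in `Q` (`B(½,½) = π` inside the rules). -/
theorem betaQ_half_half : betaQ (1 / 2) (1 / 2) = xPi := by
  rw [← mkQ_twoAtanHalfLine, betaQ_eq (by norm_num) (by norm_num), eq_comm, mkQ_eq_mkQ_iff]
  exact twoAtanHalfLine_sub_betaRep_half

end SoloBlind

end Summit.KontsevichZagierPeriods.KontsevichZagierPeriods.Theorems
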